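import Summits.CriticalPhenomena.SAWScalingLimit.Theorems.SAWRenewalTightnessRoomEntropyDefs
import Literature.Probability.RandomPlanarGeometry.LoewnerRoomObservableAdapted
import Literature.Probability.RandomPlanarGeometry.DrivingFunctionMeasurable
import Literature.Probability.RandomPlanarGeometry.SLEConvergenceCriterion
import Literature.Probability.RandomPlanarGeometry.LoewnerDescription
import Literature.Probability.Process.NaturalFiltrationMartingale
import HarnessLib

/-!
# `stub_roomCylinderToMartingale`: from the cylinder identity to the room–entropy martingales

Stub `stub_roomCylinderToMartingale` of the registered skeleton (r4) of the line
`room-entropy-wright-fisher` for the crux `SubseqIdentification` (stmt-CriticalPhenomena-0783,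
route `SAWRenewalTightness`, shared with `SAWParafermion` / `SAWLeftRightFKG` /
`SAWAsymptoticMorera`; vocabulary `Theorems/SAWRenewalTightnessRoomEntropyDefs.lean`):
`RoomCylinderIdentity → RoomMartingaleLimit`.

Let `μ` be a probability measure on curve classes (a describable subsequential limit of the
critical SAW laws of a Dobrushin domain `(D; a, b)`, but none of this is used), `φ` a chordal
uniformizing map of `D`, `W_t(c) = drivingFunction φ c t` the driving process and
`N^{w,m}_t(c) = roomObsStopped (drivingFunction φ c) w m t` the stopped room–entropy observables
(`w ∈ ℍ`, cap `m`). If the CYLINDER IDENTITY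
`E_μ[(N^{w,m}_t − N^{w,m}_s) ψ(W_{S_0}, …, W_{S_{n-1}})] = 0` holds for all `s ≤ t`, times
`S_k ≤ s` and continuous `|ψ| ≤ 1`, then there is a filtration `𝓕` of the Borel σ-algebra of
`CurveClass ℂ` to which `W` is adapted and for which every `N^{w,m}` is a martingale: the natural
filtration of `W` (coordinates strongly measurable, `stronglyMeasurable_drivingFunction_apply`).
Each `N^{w,m}` is `𝓕`-adapted (`Loewner.adapted_roomObs_min_roomStop`, paths continuous by
`continuous_drivingFunction`), bounded by `2 log (m+1) + 3 log 2`
(`Loewner.abs_roomObs_min_roomStop_le`) hence integrable, and the monotone-class form of the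
martingale property (`Literature.Probability.Process.martingale_natural_of_integral_cylinder`)
concludes. No named fact; axioms `propext`, `Classical.choice`, `Quot.sound`.

References: D. Revuz, M. Yor, *Continuous Martingales and Brownian Motion* (1999), Ch. II §1;
D. Chelkak, H. Duminil-Copin, C. Hongler, A. Kemppainen, S. Smirnov, C. R. Math. 352 (2014), §3.
-/

noncomputable section

open MeasureTheory Filter Topology Set
open scoped NNReal ENNReal Classical BigOperators
open Literature.Probability.LatticeModels
open Literature.Probability.RandomPlanarGeometry
open UpperHalfPlane (upperHalfPlaneSet)

namespace Summit.CriticalPhenomena.SAWScalingLimit.Theorems.SubseqIdentification.RoomEntropy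

/-- **The stopped room–entropy observables are martingales of the natural filtration of the
driving process** (the core of the stub, for an arbitrary probability measure `μ` on curve
classes and a chordal uniformizing map `φ`): if the cylinder identity
`E_μ[(N^{w,m}_t − N^{w,m}_s) ψ(W_S)] = 0` holds for all `w ∈ ℍ`, `m`, `s ≤ t`, `S_k ≤ s`,
continuous `|ψ| ≤ 1`, then with `𝓕` the natural filtration of `W = drivingFunction φ`, the
process `W` is `𝓕`-adapted and every `t ↦ roomObsStopped (drivingFunction φ ·) w m t` is an
`𝓕`-martingale under `μ`. [folklore] -/
theorem exists_filtration_martingale_roomObsStopped_of_integral_cylinder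
    {D : DobrushinDomain} {φ : ConformalEquiv upperHalfPlaneSet D.carrier}
    {μ : Measure (CurveClass ℂ)} (hφ : D.IsChordalUniformizing φ) (hμ : IsProbabilityMeasure μ)
    (h : ∀ w : ℂ, 0 < w.im → ∀ (m : ℕ) (s t : ℝ≥0), s ≤ t → ∀ (n : ℕ) (S : Fin n → ℝ≥0),
      (∀ k, S k ≤ s) → ∀ ψ : (Fin n → ℝ) → ℝ, Continuous ψ → (∀ v, |ψ v| ≤ 1) →
        ∫ c, (roomObsStopped (drivingFunction φ c) w m t -
            roomObsStopped (drivingFunction φ c) w m s) *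
          ψ (fun k => drivingFunction φ c (S k)) ∂μ = 0) :
    ∃ 𝓕 : Filtration ℝ≥0 (inferInstance : MeasurableSpace (CurveClass ℂ)),
      Adapted 𝓕 (fun t c => drivingFunction φ c t) ∧
      ∀ w : ℂ, 0 < w.im → ∀ m : ℕ,
        Martingale (fun t c => roomObsStopped (drivingFunction φ c) w m t) 𝓕 μ := by
  -- the natural filtration of the driving process
  have hW : ∀ t : ℝ≥0, StronglyMeasurable fun c : CurveClass ℂ ↦ drivingFunction φ c t :=
    fun t ↦ stronglyMeasurable_drivingFunction_apply hφ t
  set 𝓕 : Filtration ℝ≥0 (inferInstance : MeasurableSpace (CurveClass ℂ)) :=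
    Filtration.natural (fun (t : ℝ≥0) (c : CurveClass ℂ) ↦ drivingFunction φ c t) hW with h𝓕
  have hWad : StronglyAdapted 𝓕 fun (t : ℝ≥0) (c : CurveClass ℂ) ↦ drivingFunction φ c t :=
    Filtration.stronglyAdapted_natural hW
  have hWad' : Adapted 𝓕 fun (t : ℝ≥0) (c : CurveClass ℂ) ↦ drivingFunction φ c t :=
    hWad.adapted
  have hWc : ∀ c : CurveClass ℂ, Continuous (drivingFunction φ c) := fun c ↦
    continuous_drivingFunction φ c
  refine ⟨𝓕, hWad', fun w hw m ↦ ?_⟩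
  -- adaptedness of the stopped observable
  have hXad : Adapted 𝓕 fun (t : ℝ≥0) (c : CurveClass ℂ) ↦
      roomObsStopped (drivingFunction φ c) w m t :=
    Loewner.adapted_roomObs_min_roomStop (W := fun c : CurveClass ℂ ↦ drivingFunction φ c) 𝓕 hWc
      (fun s ↦ hWad' s) hw m
  have hXsad : StronglyAdapted 𝓕 fun (t : ℝ≥0) (c : CurveClass ℂ) ↦
      roomObsStopped (drivingFunction φ c) w m t := hXad.stronglyAdapted
  -- integrability: bounded and strongly measurable on a probability space
  have hXint : ∀ t : ℝ≥0,
      Integrable (fun c : CurveClass ℂ ↦ roomObsStopped (drivingFunction φ c) w m t) μ := by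
    intro t
    refine Integrable.of_bound (hXsad.stronglyMeasurable (i := t)).aestronglyMeasurable
      (2 * Real.log ((m : ℝ) + 1) + 3 * Real.log 2) (ae_of_all _ fun c ↦ ?_)
    rw [Real.norm_eq_abs]
    exact Loewner.abs_roomObs_min_roomStop_le (hWc c) hw m t
  exact Literature.Probability.Process.martingale_natural_of_integral_cylinder hW hXsad hXint
    (h w hw m)

/-- **`RoomCylinderIdentity → RoomMartingaleLimit`** (registered stub
`stub_roomCylinderToMartingale` of the line `room-entropy-wright-fisher`, crux
`SubseqIdentification`, stmt-CriticalPhenomena-0783): if every describable probability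
subsequential limit `μ` of the critical SAW laws of `(D; a, b)` satisfies the cylinder identity
of the stopped room–entropy observables against bounded continuous cylinder functions of the
driving process, then for every such `μ` there is a filtration to which the driving process is
adapted and for which every stopped room–entropy observable is a martingale — the natural
filtration of the driving process
(`exists_filtration_martingale_roomObsStopped_of_integral_cylinder`; the SAW hypotheses are only
carried). -/
theorem stub_roomCylinderToMartingale :
    (∀ (D : DobrushinDomain) (a b : ℝ → Site 2)
      (φ : ConformalEquiv upperHalfPlaneSet D.carrier) (μ : Measure (CurveClass ℂ)),
      SAW.IsEndpointApprox D a b → D.IsChordalUniformizing φ → IsProbabilityMeasure μ →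
      IsSubseqLimitLaw (fun δ (γ : SAW.DomainSAW D.carrier δ (a δ) (b δ)) => γ.curve)
        (fun δ => SAW.law D.carrier δ (a δ) (b δ)) μ →
      (∀ᵐ c ∂μ, IsLoewnerDescribable φ c ∧ c.source = D.pt 0) →
      ∀ w : ℂ, 0 < w.im → ∀ (m : ℕ) (s t : ℝ≥0), s ≤ t → ∀ (n : ℕ) (S : Fin n → ℝ≥0), (∀ k, S k ≤ s) →
        ∀ ψ : (Fin n → ℝ) → ℝ, Continuous ψ → (∀ v, |ψ v| ≤ 1) →
          ∫ c, (roomObsStopped (drivingFunction φ c) w m t - roomObsStopped (drivingFunction φ c) w m s) *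
              ψ (fun k => drivingFunction φ c (S k)) ∂μ = 0) →
    ∀ (D : DobrushinDomain) (a b : ℝ → Site 2)
      (φ : ConformalEquiv upperHalfPlaneSet D.carrier) (μ : Measure (CurveClass ℂ)),
      SAW.IsEndpointApprox D a b → D.IsChordalUniformizing φ → IsProbabilityMeasure μ →
      IsSubseqLimitLaw (fun δ (γ : SAW.DomainSAW D.carrier δ (a δ) (b δ)) => γ.curve)
        (fun δ => SAW.law D.carrier δ (a δ) (b δ)) μ →
      (∀ᵐ c ∂μ, IsLoewnerDescribable φ c ∧ c.source = D.pt 0) →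
      ∃ 𝓕 : Filtration ℝ≥0 (inferInstance : MeasurableSpace (CurveClass ℂ)),
        Adapted 𝓕 (fun t c => drivingFunction φ c t) ∧
        ∀ w : ℂ, 0 < w.im → ∀ m : ℕ,
          Martingale (fun t c => roomObsStopped (drivingFunction φ c) w m t) 𝓕 μ := by
  intro h D a b φ μ hab hφ hμ hlim hdesc
  exact exists_filtration_martingale_roomObsStopped_of_integral_cylinder hφ hμ
    (h D a b φ μ hab hφ hμ hlim hdesc)

end Summit.CriticalPhenomena.SAWScalingLimit.Theorems.SubseqIdentification.RoomEntropy

end
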